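import Summits.QuantumFields.BalabanUV.Beta.GAN24.T2HybridCellsComb

/-!
# `BalabanUV.Beta.GAN24.AffineUnrollProjected` — binder row G-an2-4 / (CONV-C), W-slot EXIT (α) «use the identity, not its defect» (RULING R-lead-g77-1 (2); the
# OWNER gan24-p1 g33's (α-END) INTENT I-gan24p1-g33-3, piece **(α-END-a) «THE EVEN HSPLIT»**): an affine tower PROJECTED by any additive map commuting with its
# steps is an affine tower with the projected sources; the `c • (x ± p x)` members obey the same recursion with halved sources; hence road «W3»'s level sum and the
# dressed-through-undressed `hsplit` (MY `AffineUnroll.eq_transport_add_sum` ∕ `T2HybridCells.eq_transportB_add_sum_cell`) hold VERBATIM for the even ∕ odd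
# members; instance: an2's comb `T₂` tower with `p := sgnK ∘ trK` slotwise — `T̃^{ev}_n = 𝒯^B(0,n) T̃^{ev}_0 + Σ_{l<n} 𝒯^B(l+1,n−1−l) (b̃^{ev}_l + cell_l(T̃^{ev}))` under ONE
# displayed hypothesis (the chair gan24-p2's AUTONOMY LEMMA, homogeneous half: `p` commutes with the DRESSED one-step map)
# (G-an2-4 FORMAL swarm → CRUX TEAM (2), leaf-01 lineage `b2b-balaban-gan24-formalise-leaf-01`, gen 71).

NOT IN PRINT; OUR BOOKKEEPING.  HONEST FRAMING (cell contract, verbatim): «discharging `BetaPertH` makes Bałaban's UV stability UNCONDITIONAL — a real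
constructive-QFT result; it is NOT the continuum limit and NOT the Clay problem.»  HONEST DEPENDENCY (verbatim): «continuum YM on T⁴ ⇐ BetaPertH ∧ nine spine
estimates (0/9 proved); BetaPertH ⇐ (D1) ∧ (D4) ∧ CAP+tail; G-an2-4 gates asym, D1 and NE2/3/4.»  [folklore] additive-group algebra over MY `AffineUnroll` ∕
`T2HybridCells` ∕ `T2HybridCellsComb` frame (the slotwise parity's additivity ∕ homogeneity proved pointwise from `sgnK_apply` ∕ `trK_apply`), leaf-04 ∕ leaf-02's
`Lin4Additive.{lin4_bdd, lin4_smul}`, MY `T2UnitSplitLevels.{bdd₄_zero, bdd₄_add, bdd₄_sub, lin4_add_of_bdd₄}`, the road-P2 chair's `T2RecOfUnitSplit` ∕ `T2RecHybridSplit`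
letters.  No cited fact, no `def`, no `def … : Prop`, 0 sorry.  Asserts NO shape, NO bound, NO rate of any table; the one-step commutation `hpA` is a DISPLAYED
HYPOTHESIS (the chair gan24-p2's INTENT 3; the OWNER's ASK l.49438), not a theorem of this file; discharges NOTHING of «T2Shape» ∕ «T2Drift» ∕ (hW, hWall) ∕ (C) ∕ (Q-L);
(β) of record untouched; NEVER «G-an2-4 closed» as (CONV-C); NOT D1, NOT BetaPertH, NOT continuum, NOT Clay.

* §1 (abstract; `E` an additive commutative group, class `P`, steps `A : ℕ → E → E` preserving `P`, a map `p : E → E` with `hpA : ∀ j x, P x → p (A j x) = A j (p x)`):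
  **`map_transport_comm`** (`p (𝒯^A(m,k) x) = 𝒯^A(m,k) (p x)` on `P`), **`map_rec`** (the image sequence obeys the recursion with the image sources).
* §2 (`E` an `R`-module; `A j` additive AND homogeneous on `P`; `P` closed under `+`, scalars; `p` class-preserving and additive on `P`; `c ε : R`):
  **`half_rec`** — `y j := c • (x j + ε • p (x j))` obeys `y (j+1) = A j (y j) + c • (b j + ε • p (b j))`; **`half_mem`**; **`half_eq_transport_add_sum`** (road W3's level
  sum for `y`); **`half_eq_transportB_add_sum_cell`** — `y n = 𝒯^B(0,n) y 0 + Σ_{l<n} 𝒯^B(l+1,n−1−l) (c • (b l + ε • p (b l)) + (A l (y l) − B l (y l)))` for ANY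
  class-preserving `B` additive on `P` (`B` need NOT commute with `p`).
* §3 (bi-tables, `p T κ u κ′ u′ := sgnK (trK (T κ u κ′ u′))`, class `bdd₄`): `bdd₄_parity`, `parity_add`, `parity_smul`, `bdd₄_smul`; and THE COMB-MEMBER INSTANCE
  **`unitS₂_T2RecAt_half_eq_transportB_add_sum_cell`** = (α-END-a): for an2's comb tower (in-block root, any pins, any initial table, any off-diagonal `LocStencil₂`
  border), `c = ½`, any `ε` (`ε = 1`: the even member; `ε = −1`: the odd member), with the DRESSED one-step maps `𝒜^Ĝ_j = lin4 c₄ (unitK_j Ĝ_j) Lc` and road W3's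
  UNDRESSED transport of record `𝒯^B`, `B j = lin4 c₄ (unitK_j K_j) Lc`, under the displayed `hpA` for `𝒜^Ĝ`.
-/

noncomputable section

open Finset
open scoped BigOperators
open Literature.MathematicalPhysics.QuantumFieldTheory
open Literature.MathematicalPhysics.QuantumFieldTheory.Balaban1983to89
open Literature.MathematicalPhysics.QuantumFieldTheory.Balaban1983to89.Beta
open ExpKernelCalculus (MKer Decays BiLoc VertexFamily VertexFamily₂)
open OneStepResolventKernel (Fib LocStencil)
open OneStepKernelFamily (KInvStep decays_KInvStep)
open AffineAveraging (box toSite)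
open AveragingMixedJetTables (mixFFAt)
open SecondOrderResponse (W2SymOfK LocStencilFM)
open BalabanCompositeJets (LocStencil₂)
open BalabanStepJetsSucc (mmRead)
open BalabanStepW2 (K3OfK M2Of)
open Summit.QuantumFields.BalabanUV.Beta.TameKernelCalculus (trK trK_apply)
open Summit.QuantumFields.BalabanUV.Beta.BorderedHessian (sgnF sgnK sgnK_apply)
open Summit.QuantumFields.BalabanUV.Beta.HessKerDressedUnits (unitK unitS decays_unitK)
open Summit.QuantumFields.BalabanUV.Beta.SecondOrderUnits (unitM unitS₂ unitM₂)
open Summit.QuantumFields.BalabanUV.Beta.AxialDressingRooted (coDressKBmAt decays_coDressKBmAt_KInvStep)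
open Summit.QuantumFields.BalabanUV.Beta.SpineRooted (T2RecOf T2RecAt SpureRecAt M1At T2RecOf_comb locStencil_SpureRecAt vertexFamily_M1At)
open Summit.QuantumFields.BalabanUV.Beta.MixedJetTablesPlug (hmix_an1)
open Summit.QuantumFields.BalabanUV.Beta.GAN24.CombesThomas (sfStep smStep)
open Summit.QuantumFields.BalabanUV.Beta.GAN24.T2RecursionAffine (lin4)
open Summit.QuantumFields.BalabanUV.Beta.GAN24.AffineUnroll (transport transport_succ transport_mem mem_of_rec eq_transport_add_sum)
open Summit.QuantumFields.BalabanUV.Beta.GAN24.Lin4Additive (lin4_bdd lin4_smul)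
open Summit.QuantumFields.BalabanUV.Beta.GAN24.T2UnitSplitLevels (bdd₄_zero bdd₄_add bdd₄_sub lin4_add_of_bdd₄)
open Summit.QuantumFields.BalabanUV.Beta.GAN24.T2RecOfUnitSplit (bdd₄_unitS₂_T2RecOf_of_letters)
open Summit.QuantumFields.BalabanUV.Beta.GAN24.T2RecHybridSplit (bdd₄_source_of_letters)
open Summit.QuantumFields.BalabanUV.Beta.GAN24.T2HybridCells (eq_transportB_add_sum_cell)
open Summit.QuantumFields.BalabanUV.Beta.GAN24.T2HybridCellsComb (succ_eq_lin4_add_of_letters)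

namespace Summit.QuantumFields.BalabanUV.Beta.GAN24.AffineUnrollProjected

/-! ## §1 Abstract: a map commuting with the steps commutes with the transport; the image tower -/

section Generic

variable {E : Type*} [AddCommGroup E] {A : ℕ → E → E} {P : E → Prop} {p : E → E}

omit [AddCommGroup E] in
/-- [folklore] **A MAP COMMUTING WITH EVERY STEP ON THE CLASS COMMUTES WITH THE COMPOSITE TRANSPORT ON THE CLASS**:
`P x ⟹ p (transport A m k x) = transport A m k (p x)` (induction on `k`; `transport_mem`). -/
theorem map_transport_comm (hAP : ∀ j x, P x → P (A j x)) (hpA : ∀ j x, P x → p (A j x) = A j (p x)) (m k : ℕ) {x : E} (hx : P x) :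
    p (transport A m k x) = transport A m k (p x) := by
  induction k with
  | zero => simp
  | succ k ih => rw [transport_succ, transport_succ, hpA _ _ (transport_mem hAP m k hx), ih]

/-- [folklore] **THE IMAGE TOWER**: along an affine recursion `x (j+1) = A j (x j) + b j` started and sourced in the class, a class-additive `p` commuting with
the steps gives `p (x (j+1)) = A j (p (x j)) + p (b j)` — the image sequence obeys the same recursion with the image sources. -/
theorem map_rec (hPadd : ∀ x y, P x → P y → P (x + y)) (hAP : ∀ j x, P x → P (A j x)) (hpA : ∀ j x, P x → p (A j x) = A j (p x))
    (hpadd : ∀ x y, P x → P y → p (x + y) = p x + p y) {x b : ℕ → E} (hx0 : P (x 0)) (hb : ∀ j, P (b j))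
    (hrec : ∀ j, x (j + 1) = A j (x j) + b j) (j : ℕ) : p (x (j + 1)) = A j (p (x j)) + p (b j) := by
  have hxP : ∀ j, P (x j) := mem_of_rec hPadd hAP hx0 hb hrec
  rw [hrec j, hpadd _ _ (hAP _ _ (hxP j)) (hb j), hpA _ _ (hxP j)]

end Generic

/-! ## §2 Abstract: the `c • (x + ε • p x)` members obey the recursion with halved sources; their level sums -/

section Half

variable {R : Type*} [CommRing R] {E : Type*} [AddCommGroup E] [Module R E] {A B : ℕ → E → E} {P : E → Prop} {p : E → E}

/-- [folklore] **THE HALVED MEMBER OBEYS THE RECURSION WITH THE HALVED SOURCES**: with `y j := c • (x j + ε • p (x j))`,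
`y (j+1) = A j (y j) + c • (b j + ε • p (b j))` — `A j` additive and homogeneous on the class, `p` class-preserving, class-additive and commuting with `A j`. -/
theorem half_rec (hPadd : ∀ x y, P x → P y → P (x + y)) (hPsmul : ∀ (r : R) x, P x → P (r • x)) (hAP : ∀ j x, P x → P (A j x))
    (hAadd : ∀ j x y, P x → P y → A j (x + y) = A j x + A j y) (hAsmul : ∀ j (r : R) x, P x → A j (r • x) = r • A j x)
    (hpP : ∀ x, P x → P (p x)) (hpadd : ∀ x y, P x → P y → p (x + y) = p x + p y) (hpA : ∀ j x, P x → p (A j x) = A j (p x))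
    {x b : ℕ → E} (hx0 : P (x 0)) (hb : ∀ j, P (b j)) (hrec : ∀ j, x (j + 1) = A j (x j) + b j) (c ε : R) (j : ℕ) :
    c • (x (j + 1) + ε • p (x (j + 1))) = A j (c • (x j + ε • p (x j))) + c • (b j + ε • p (b j)) := by
  have hxP : ∀ j, P (x j) := mem_of_rec hPadd hAP hx0 hb hrec
  have h1 : p (x (j + 1)) = A j (p (x j)) + p (b j) := map_rec hPadd hAP hpA hpadd hx0 hb hrec j
  have hpx : P (ε • p (x j)) := hPsmul ε _ (hpP _ (hxP j))
  rw [h1, hrec j, hAsmul j c _ (hPadd _ _ (hxP j) hpx), hAadd j _ _ (hxP j) hpx, hAsmul j ε _ (hpP _ (hxP j))]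
  simp only [smul_add]
  abel

/-- [folklore] The halved member and the halved sources are in the class. -/
theorem half_mem (hPadd : ∀ x y, P x → P y → P (x + y)) (hPsmul : ∀ (r : R) x, P x → P (r • x)) (hpP : ∀ x, P x → P (p x))
    {z : E} (hz : P z) (c ε : R) : P (c • (z + ε • p z)) :=
  hPsmul c _ (hPadd _ _ hz (hPsmul ε _ (hpP _ hz)))

/-- [folklore] **ROAD W3's LEVEL SUM FOR THE HALVED MEMBER** (MY `AffineUnroll.eq_transport_add_sum` on `half_rec`):
`c • (x n + ε • p (x n)) = 𝒯^A(0,n) (c • (x 0 + ε • p (x 0))) + Σ_{m<n} 𝒯^A(m+1,n−1−m) (c • (b m + ε • p (b m)))`. -/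
theorem half_eq_transport_add_sum (hP0 : P 0) (hPadd : ∀ x y, P x → P y → P (x + y)) (hPsmul : ∀ (r : R) x, P x → P (r • x))
    (hAP : ∀ j x, P x → P (A j x)) (hAadd : ∀ j x y, P x → P y → A j (x + y) = A j x + A j y)
    (hAsmul : ∀ j (r : R) x, P x → A j (r • x) = r • A j x) (hpP : ∀ x, P x → P (p x))
    (hpadd : ∀ x y, P x → P y → p (x + y) = p x + p y) (hpA : ∀ j x, P x → p (A j x) = A j (p x))
    {x b : ℕ → E} (hx0 : P (x 0)) (hb : ∀ j, P (b j)) (hrec : ∀ j, x (j + 1) = A j (x j) + b j) (c ε : R) (n : ℕ) :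
    c • (x n + ε • p (x n)) = transport A 0 n (c • (x 0 + ε • p (x 0))) +
      ∑ m ∈ Finset.range n, transport A (m + 1) (n - 1 - m) (c • (b m + ε • p (b m))) :=
  eq_transport_add_sum (A := A) (P := P) (x := fun j => c • (x j + ε • p (x j))) (b := fun j => c • (b j + ε • p (b j)))
    hP0 hPadd hAP hAadd (half_mem hPadd hPsmul hpP hx0 c ε) (fun j => half_mem hPadd hPsmul hpP (hb j) c ε)
    (fun j => half_rec hPadd hPsmul hAP hAadd hAsmul hpP hpadd hpA hx0 hb hrec c ε j) n

/-- [folklore] **THE DRESSED-THROUGH-UNDRESSED `hsplit` FOR THE HALVED MEMBER** (MY `T2HybridCells.eq_transportB_add_sum_cell` on `half_rec`): for ANY second family `B`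
preserving the class and additive on it (NO commutation of `B` with `p` is asked),
`c • (x n + ε • p (x n)) = 𝒯^B(0,n) y₀ + Σ_{m<n} 𝒯^B(m+1,n−1−m) (c • (b m + ε • p (b m)) + (A m (y m) − B m (y m)))`, `y m := c • (x m + ε • p (x m))`. -/
theorem half_eq_transportB_add_sum_cell (hP0 : P 0) (hPadd : ∀ x y, P x → P y → P (x + y)) (hPsub : ∀ x y, P x → P y → P (x - y))
    (hPsmul : ∀ (r : R) x, P x → P (r • x)) (hAP : ∀ j x, P x → P (A j x)) (hAadd : ∀ j x y, P x → P y → A j (x + y) = A j x + A j y)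
    (hAsmul : ∀ j (r : R) x, P x → A j (r • x) = r • A j x) (hBP : ∀ j x, P x → P (B j x))
    (hBadd : ∀ j x y, P x → P y → B j (x + y) = B j x + B j y) (hpP : ∀ x, P x → P (p x))
    (hpadd : ∀ x y, P x → P y → p (x + y) = p x + p y) (hpA : ∀ j x, P x → p (A j x) = A j (p x))
    {x b : ℕ → E} (hx0 : P (x 0)) (hb : ∀ j, P (b j)) (hrec : ∀ j, x (j + 1) = A j (x j) + b j) (c ε : R) (n : ℕ) :
    c • (x n + ε • p (x n)) = transport B 0 n (c • (x 0 + ε • p (x 0))) +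
      ∑ m ∈ Finset.range n, transport B (m + 1) (n - 1 - m)
        (c • (b m + ε • p (b m)) + (A m (c • (x m + ε • p (x m))) - B m (c • (x m + ε • p (x m))))) :=
  eq_transportB_add_sum_cell (A := A) (B := B) (P := P) (x := fun j => c • (x j + ε • p (x j))) (b := fun j => c • (b j + ε • p (b j)))
    hP0 hPadd hPsub hAP hBP hBadd (half_mem hPadd hPsmul hpP hx0 c ε) (fun j => half_mem hPadd hPsmul hpP (hb j) c ε)
    (fun j => half_rec hPadd hPsmul hAP hAadd hAsmul hpP hpadd hpA hx0 hb hrec c ε j) n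

end Half

/-! ## §3 Bi-tables with `p := sgnK ∘ trK` slotwise; the comb-member instance (α-END-a) -/

section Tables

variable {d : ℕ}

/-- [folklore] `|sgnF a| = 1`. -/
theorem abs_sgnF (a : Fib d) : |sgnF a| = 1 := by
  rcases a with κ | κ <;> simp [BorderedHessian.sgnF]

/-- [folklore] The slotwise parity image of a bounded bi-table is bounded (same bound). -/
theorem bdd₄_parity {X : Fin (d + 1) → (Fin (d + 1) → ℤ) → Fin (d + 1) → (Fin (d + 1) → ℤ) → MKer (d + 1) (Fib d)}
    (hX : ∃ B : ℝ, ∀ κ u κ' u' x z a b, |X κ u κ' u' x z a b| ≤ B) :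
    ∃ B : ℝ, ∀ κ u κ' u' x z a b, |(fun κ u κ' u' => sgnK (trK (X κ u κ' u'))) κ u κ' u' x z a b| ≤ B := by
  obtain ⟨B, h⟩ := hX
  refine ⟨B, fun κ u κ' u' x z a b => ?_⟩
  simp only [sgnK_apply, trK_apply, abs_mul, abs_sgnF, one_mul]
  exact h κ u κ' u' z x b a

/-- [folklore] The slotwise parity image is additive. -/
theorem parity_add (X Y : Fin (d + 1) → (Fin (d + 1) → ℤ) → Fin (d + 1) → (Fin (d + 1) → ℤ) → MKer (d + 1) (Fib d)) :
    (fun κ u κ' u' => sgnK (trK ((X + Y) κ u κ' u'))) =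
      (fun κ u κ' u' => sgnK (trK (X κ u κ' u'))) + fun κ u κ' u' => sgnK (trK (Y κ u κ' u')) := by
  funext κ u κ' u' x z a b
  simp only [Pi.add_apply, sgnK_apply, trK_apply]
  ring

/-- [folklore] The slotwise parity image commutes with scalars. -/
theorem parity_smul (r : ℝ) (X : Fin (d + 1) → (Fin (d + 1) → ℤ) → Fin (d + 1) → (Fin (d + 1) → ℤ) → MKer (d + 1) (Fib d)) :
    (fun κ u κ' u' => sgnK (trK ((r • X) κ u κ' u'))) = r • fun κ u κ' u' => sgnK (trK (X κ u κ' u')) := by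
  funext κ u κ' u' x z a b
  simp only [Pi.smul_apply, sgnK_apply, trK_apply, smul_eq_mul]
  ring

/-- [folklore] Scalar multiples of bounded bi-tables are bounded. -/
theorem bdd₄_smul (r : ℝ) {X : Fin (d + 1) → (Fin (d + 1) → ℤ) → Fin (d + 1) → (Fin (d + 1) → ℤ) → MKer (d + 1) (Fib d)}
    (hX : ∃ B : ℝ, ∀ κ u κ' u' x z a b, |X κ u κ' u' x z a b| ≤ B) :
    ∃ B : ℝ, ∀ κ u κ' u' x z a b, |(r • X) κ u κ' u' x z a b| ≤ B := by
  obtain ⟨B, h⟩ := hX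
  refine ⟨|r| * B, fun κ u κ' u' x z a b => ?_⟩
  simp only [Pi.smul_apply, smul_eq_mul, abs_mul]
  exact mul_le_mul_of_nonneg_left (h κ u κ' u' x z a b) (abs_nonneg r)

variable {Lc : ℕ} [NeZero Lc] (G K : ℕ → MKer (d + 1) (Fib d)) (S M : ℕ → Fin (d + 1) → (Fin (d + 1) → ℤ) → MKer (d + 1) (Fib d)) (cE₂ cB : ℝ)
  (Tc : Fin 4 → Fin 4 → Fin 4 → Fin 4 → ℝ)
  {vh₂S mixFF : Fin (d + 1) → (Fin (d + 1) → ℤ) → Fin (d + 1) → (Fin (d + 1) → ℤ) → MKer (d + 1) (Fib d)}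

/-- NOT IN PRINT; OUR BOOKKEEPING.  **(α-END-a) FOR THE SLOTTED FAMILY, LETTERS DISPLAYED**: for ANY resolvent family `G` and ANY second kernel family `K` decaying per level,
the letters (LS)(LM), the off-diagonal `LocStencil₂` border, the mixed table, and the ONE displayed commutation `hpA` of the slotwise parity `p := sgnK ∘ trK` with the
DRESSED one-step maps `lin4 c₄ (unitK_j (G j)) Lc` on bounded bi-tables: the halved member `y_n := c • (T̃_n + ε • p T̃_n)` of the slotted unit `T₂` tower satisfies road W3's
`hsplit` through the transport of `B j := lin4 c₄ (unitK_j (K j)) Lc` with sources `c • (b̃_l + ε • p b̃_l)` and cells `𝒜^G_l y_l − 𝒜^K_l y_l`. -/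
theorem unitS₂_T2RecOf_half_eq_transportB_add_sum_cell_of_letters (hLc : 1 ≤ Lc)
    (hBff : ∀ κ u κ' u' x z (α β : Fin (d + 1)), vh₂S κ u κ' u' x z (Sum.inl α) (Sum.inl β) = 0)
    (hBmm : ∀ κ u κ' u' x z (μ ν : Fin (d + 1)), vh₂S κ u κ' u' x z (Sum.inr μ) (Sum.inr ν) = 0)
    (hG : ∀ j : ℕ, ∃ δ C : ℝ, 0 < δ ∧ 0 ≤ C ∧ Decays (G j) C δ) (hK : ∀ j : ℕ, ∃ δ C : ℝ, 0 < δ ∧ 0 ≤ C ∧ Decays (K j) C δ)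
    (hS : ∀ j : ℕ, ∃ Cs δ : ℝ, 0 < δ ∧ LocStencil (S j) Cs δ) (hM : ∀ j : ℕ, ∃ CM δ : ℝ, 0 < δ ∧ VertexFamily (M j) Lc CM δ)
    (hBl : ∃ C δ : ℝ, 0 < δ ∧ LocStencil₂ vh₂S C δ) (hmix : ∃ C δ : ℝ, 0 < δ ∧ LocStencilFM Lc mixFF C δ)
    (hpA : ∀ (j : ℕ) (X : Fin (d + 1) → (Fin (d + 1) → ℤ) → Fin (d + 1) → (Fin (d + 1) → ℤ) → MKer (d + 1) (Fib d)),
      (∃ B : ℝ, ∀ κ u κ' u' x z a b, |X κ u κ' u' x z a b| ≤ B) →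
        (fun κ u κ' u' => sgnK (trK (lin4 (cE₂ * (Lc : ℝ) ^ (2 * (d + 1))) (unitK (sfStep Lc j) (smStep d Lc j) (G j)) Lc X κ u κ' u'))) =
          lin4 (cE₂ * (Lc : ℝ) ^ (2 * (d + 1))) (unitK (sfStep Lc j) (smStep d Lc j) (G j)) Lc (fun κ u κ' u' => sgnK (trK (X κ u κ' u'))))
    (c ε : ℝ) (n : ℕ) :
    c • (unitS₂ (sfStep Lc n) (smStep d Lc n) (T2RecOf d Lc G S M cE₂ cB Tc vh₂S mixFF n) +
        ε • fun κ u κ' u' => sgnK (trK (unitS₂ (sfStep Lc n) (smStep d Lc n) (T2RecOf d Lc G S M cE₂ cB Tc vh₂S mixFF n) κ u κ' u'))) =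
      transport (fun j => lin4 (cE₂ * (Lc : ℝ) ^ (2 * (d + 1))) (unitK (sfStep Lc j) (smStep d Lc j) (K j)) Lc) 0 n
          (c • (unitS₂ (sfStep Lc 0) (smStep d Lc 0) (T2RecOf d Lc G S M cE₂ cB Tc vh₂S mixFF 0) +
            ε • fun κ u κ' u' => sgnK (trK (unitS₂ (sfStep Lc 0) (smStep d Lc 0) (T2RecOf d Lc G S M cE₂ cB Tc vh₂S mixFF 0) κ u κ' u')))) +
        ∑ l ∈ Finset.range n, transport (fun j => lin4 (cE₂ * (Lc : ℝ) ^ (2 * (d + 1))) (unitK (sfStep Lc j) (smStep d Lc j) (K j)) Lc) (l + 1) (n - 1 - l)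
          (c • ((fun κ u κ' u' => (cE₂ * (Lc : ℝ) ^ (2 * (d + 1))) • mmRead Lc (K3OfK (unitK (sfStep Lc l) (smStep d Lc l) (G l)) Lc
              (unitS (sfStep Lc l) (smStep d Lc l) (S l)) (unitM (sfStep Lc l) (smStep d Lc l) (M l)) (W2SymOfK
              (unitK (sfStep Lc l) (smStep d Lc l) (G l)) Lc (unitS (sfStep Lc l) (smStep d Lc l) (S l))
              (unitM (sfStep Lc l) (smStep d Lc l) (M l)) 0
              (unitM₂ (sfStep Lc l) (smStep d Lc l) (M2Of d Lc mixFF l))) κ u κ' u') + cB • vh₂S κ u κ' u') +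
            ε • fun κ u κ' u' => sgnK (trK ((fun κ u κ' u' => (cE₂ * (Lc : ℝ) ^ (2 * (d + 1))) • mmRead Lc (K3OfK (unitK (sfStep Lc l) (smStep d Lc l) (G l)) Lc
              (unitS (sfStep Lc l) (smStep d Lc l) (S l)) (unitM (sfStep Lc l) (smStep d Lc l) (M l)) (W2SymOfK
              (unitK (sfStep Lc l) (smStep d Lc l) (G l)) Lc (unitS (sfStep Lc l) (smStep d Lc l) (S l))
              (unitM (sfStep Lc l) (smStep d Lc l) (M l)) 0
              (unitM₂ (sfStep Lc l) (smStep d Lc l) (M2Of d Lc mixFF l))) κ u κ' u') + cB • vh₂S κ u κ' u') κ u κ' u'))) +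
           (lin4 (cE₂ * (Lc : ℝ) ^ (2 * (d + 1))) (unitK (sfStep Lc l) (smStep d Lc l) (G l)) Lc
              (c • (unitS₂ (sfStep Lc l) (smStep d Lc l) (T2RecOf d Lc G S M cE₂ cB Tc vh₂S mixFF l) +
                ε • fun κ u κ' u' => sgnK (trK (unitS₂ (sfStep Lc l) (smStep d Lc l) (T2RecOf d Lc G S M cE₂ cB Tc vh₂S mixFF l) κ u κ' u')))) -
            lin4 (cE₂ * (Lc : ℝ) ^ (2 * (d + 1))) (unitK (sfStep Lc l) (smStep d Lc l) (K l)) Lc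
              (c • (unitS₂ (sfStep Lc l) (smStep d Lc l) (T2RecOf d Lc G S M cE₂ cB Tc vh₂S mixFF l) +
                ε • fun κ u κ' u' => sgnK (trK (unitS₂ (sfStep Lc l) (smStep d Lc l) (T2RecOf d Lc G S M cE₂ cB Tc vh₂S mixFF l) κ u κ' u')))))) := by
  have hGu : ∀ j, ∃ C δ : ℝ, 0 < δ ∧ Decays (unitK (sfStep Lc j) (smStep d Lc j) (G j)) C δ := fun j => by
    obtain ⟨δ, C, hδ, -, h⟩ := hG j
    exact ⟨_, δ, hδ, decays_unitK (sf := sfStep Lc j) (sm := smStep d Lc j) h⟩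
  have hKu : ∀ j, ∃ C δ : ℝ, 0 < δ ∧ Decays (unitK (sfStep Lc j) (smStep d Lc j) (K j)) C δ := fun j => by
    obtain ⟨δ, C, hδ, -, h⟩ := hK j
    exact ⟨_, δ, hδ, decays_unitK (sf := sfStep Lc j) (sm := smStep d Lc j) h⟩
  have hrec := succ_eq_lin4_add_of_letters G S M cE₂ cB Tc hLc hBff hBmm hG hS hM hBl hmix
  have hb := fun j => bdd₄_source_of_letters G S M cE₂ cB vh₂S mixFF Tc hLc hBff hBmm hG hS hM hBl hmix j
  refine half_eq_transportB_add_sum_cell (R := ℝ)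
    (A := fun j => lin4 (cE₂ * (Lc : ℝ) ^ (2 * (d + 1))) (unitK (sfStep Lc j) (smStep d Lc j) (G j)) Lc)
    (B := fun j => lin4 (cE₂ * (Lc : ℝ) ^ (2 * (d + 1))) (unitK (sfStep Lc j) (smStep d Lc j) (K j)) Lc)
    (P := fun X => ∃ B : ℝ, ∀ κ u κ' u' x z a b, |X κ u κ' u' x z a b| ≤ B)
    (p := fun X => fun κ u κ' u' => sgnK (trK (X κ u κ' u')))
    (x := fun j => unitS₂ (sfStep Lc j) (smStep d Lc j) (T2RecOf d Lc G S M cE₂ cB Tc vh₂S mixFF j))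
    bdd₄_zero (fun _ _ => bdd₄_add) (fun _ _ => bdd₄_sub) (fun r _ h => bdd₄_smul r h) (fun j Y hY => ?_) (fun j Y Z hY hZ => ?_)
    (fun j r Y _ => lin4_smul _ _ _ r Y) (fun j Y hY => ?_) (fun j Y Z hY hZ => ?_) (fun Y hY => bdd₄_parity hY)
    (fun Y Z _ _ => parity_add Y Z) (fun j Y hY => hpA j Y hY)
    (bdd₄_unitS₂_T2RecOf_of_letters G S M cE₂ cB Tc hLc hG hS hM hBl hmix 0) hb hrec c ε n
  · obtain ⟨C, δ, hδ, h⟩ := hGu j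
    exact lin4_bdd h hδ _ Lc hY
  · obtain ⟨C, δ, hδ, h⟩ := hGu j
    exact lin4_add_of_bdd₄ h hδ _ Lc hY hZ
  · obtain ⟨C, δ, hδ, h⟩ := hKu j
    exact lin4_bdd h hδ _ Lc hY
  · obtain ⟨C, δ, hδ, h⟩ := hKu j
    exact lin4_add_of_bdd₄ h hδ _ Lc hY hZ

end Tables

/-! ## §4 The COMB data: letters discharged (asym1 ∕ an2 ∕ an1, as in MY `T2HybridCellsComb` §4) -/

section Comb

variable {d : ℕ} {Lc : ℕ} [NeZero Lc] {r : Fin (d + 1) → ℕ}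

/-- NOT IN PRINT; OUR BOOKKEEPING.  **(α-END-a) «THE EVEN HSPLIT» FOR an2's COMB `T₂` TOWER** (in-block root `ρ = toSite r`, any pins `(cE, cVH, cΛ, cE₂, cB)`, any initial table
`Tc`, any off-diagonal `LocStencil₂` border; `T̃_j = unitS₂_j (T2RecAt d Lc ρ … j)`, `Ĝ_j = coDressKBmAt ρ Lc (KInvStep Lc j)`, `K_j = KInvStep Lc j`, `c₄ = cE₂·Lc^{2(d+1)}`,
`p T κ u κ′ u′ := sgnK (trK (T κ u κ′ u′))`): under the ONE displayed hypothesis `hpA` — the slotwise parity commutes with the DRESSED one-step maps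
`lin4 c₄ (unitK_j Ĝ_j) Lc` on bounded bi-tables (the chair gan24-p2's AUTONOMY LEMMA, homogeneous half) — for every `c ε` (`c = ½, ε = 1`: the EVEN member
`T̃^{ev}`; `ε = −1`: the ODD member) and every `n`:
`c • (T̃_n + ε • p T̃_n) = 𝒯^B(0,n) (c • (T̃_0 + ε • p T̃_0)) + Σ_{l<n} 𝒯^B(l+1,n−1−l) (c • (b̃_l + ε • p b̃_l) + (𝒜^Ĝ_l y_l − 𝒜^K_l y_l))`, `y_l = c • (T̃_l + ε • p T̃_l)`,
`𝒯^B` road W3's UNDRESSED transport of record, `b̃_l` the dressed source.  The cells need NO commutation of `p` with `𝒜^K` or with leaf-06's dressing `𝔇`. -/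
theorem unitS₂_T2RecAt_half_eq_transportB_add_sum_cell (hLc : 1 ≤ Lc) (hr : r ∈ box (d + 1) Lc) (cE cVH cΛ cE₂ cB : ℝ)
    (Tc : Fin 4 → Fin 4 → Fin 4 → Fin 4 → ℝ) {vh₂S : Fin (d + 1) → (Fin (d + 1) → ℤ) → Fin (d + 1) → (Fin (d + 1) → ℤ) → MKer (d + 1) (Fib d)}
    (hBff : ∀ κ u κ' u' x z (α β : Fin (d + 1)), vh₂S κ u κ' u' x z (Sum.inl α) (Sum.inl β) = 0)
    (hBmm : ∀ κ u κ' u' x z (μ ν : Fin (d + 1)), vh₂S κ u κ' u' x z (Sum.inr μ) (Sum.inr ν) = 0)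
    (hB : ∃ C δ : ℝ, 0 < δ ∧ LocStencil₂ vh₂S C δ)
    (hpA : ∀ (j : ℕ) (X : Fin (d + 1) → (Fin (d + 1) → ℤ) → Fin (d + 1) → (Fin (d + 1) → ℤ) → MKer (d + 1) (Fib d)),
      (∃ B : ℝ, ∀ κ u κ' u' x z a b, |X κ u κ' u' x z a b| ≤ B) →
        (fun κ u κ' u' => sgnK (trK (lin4 (cE₂ * (Lc : ℝ) ^ (2 * (d + 1)))
          (unitK (sfStep Lc j) (smStep d Lc j) (coDressKBmAt (toSite r) Lc (KInvStep (d := d) Lc j))) Lc X κ u κ' u'))) =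
          lin4 (cE₂ * (Lc : ℝ) ^ (2 * (d + 1))) (unitK (sfStep Lc j) (smStep d Lc j) (coDressKBmAt (toSite r) Lc (KInvStep (d := d) Lc j))) Lc
            (fun κ u κ' u' => sgnK (trK (X κ u κ' u'))))
    (c ε : ℝ) (n : ℕ) :
    c • (unitS₂ (sfStep Lc n) (smStep d Lc n) (T2RecAt d Lc (toSite r) cE cVH cΛ cE₂ cB Tc vh₂S (mixFFAt (toSite r) Lc) n) +
        ε • fun κ u κ' u' => sgnK (trK (unitS₂ (sfStep Lc n) (smStep d Lc n) (T2RecAt d Lc (toSite r) cE cVH cΛ cE₂ cB Tc vh₂S (mixFFAt (toSite r) Lc) n) κ u κ' u'))) =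
      transport (fun j => lin4 (cE₂ * (Lc : ℝ) ^ (2 * (d + 1))) (unitK (sfStep Lc j) (smStep d Lc j) (KInvStep (d := d) Lc j)) Lc) 0 n
          (c • (unitS₂ (sfStep Lc 0) (smStep d Lc 0) (T2RecAt d Lc (toSite r) cE cVH cΛ cE₂ cB Tc vh₂S (mixFFAt (toSite r) Lc) 0) +
            ε • fun κ u κ' u' => sgnK (trK (unitS₂ (sfStep Lc 0) (smStep d Lc 0) (T2RecAt d Lc (toSite r) cE cVH cΛ cE₂ cB Tc vh₂S (mixFFAt (toSite r) Lc) 0) κ u κ' u')))) +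
        ∑ l ∈ Finset.range n, transport (fun j => lin4 (cE₂ * (Lc : ℝ) ^ (2 * (d + 1))) (unitK (sfStep Lc j) (smStep d Lc j) (KInvStep (d := d) Lc j)) Lc) (l + 1) (n - 1 - l)
          (c • ((fun κ u κ' u' => (cE₂ * (Lc : ℝ) ^ (2 * (d + 1))) • mmRead Lc (K3OfK (unitK (sfStep Lc l) (smStep d Lc l) (coDressKBmAt (toSite r) Lc (KInvStep (d := d) Lc l))) Lc
              (unitS (sfStep Lc l) (smStep d Lc l) (SpureRecAt d Lc (toSite r) cE cVH cΛ l)) (unitM (sfStep Lc l) (smStep d Lc l) (M1At d Lc (toSite r) cΛ l)) (W2SymOfK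
              (unitK (sfStep Lc l) (smStep d Lc l) (coDressKBmAt (toSite r) Lc (KInvStep (d := d) Lc l))) Lc (unitS (sfStep Lc l) (smStep d Lc l) (SpureRecAt d Lc (toSite r) cE cVH cΛ l))
              (unitM (sfStep Lc l) (smStep d Lc l) (M1At d Lc (toSite r) cΛ l)) 0
              (unitM₂ (sfStep Lc l) (smStep d Lc l) (M2Of d Lc (mixFFAt (toSite r) Lc) l))) κ u κ' u') + cB • vh₂S κ u κ' u') +
            ε • fun κ u κ' u' => sgnK (trK ((fun κ u κ' u' => (cE₂ * (Lc : ℝ) ^ (2 * (d + 1))) • mmRead Lc (K3OfK (unitK (sfStep Lc l) (smStep d Lc l) (coDressKBmAt (toSite r) Lc (KInvStep (d := d) Lc l))) Lc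
              (unitS (sfStep Lc l) (smStep d Lc l) (SpureRecAt d Lc (toSite r) cE cVH cΛ l)) (unitM (sfStep Lc l) (smStep d Lc l) (M1At d Lc (toSite r) cΛ l)) (W2SymOfK
              (unitK (sfStep Lc l) (smStep d Lc l) (coDressKBmAt (toSite r) Lc (KInvStep (d := d) Lc l))) Lc (unitS (sfStep Lc l) (smStep d Lc l) (SpureRecAt d Lc (toSite r) cE cVH cΛ l))
              (unitM (sfStep Lc l) (smStep d Lc l) (M1At d Lc (toSite r) cΛ l)) 0
              (unitM₂ (sfStep Lc l) (smStep d Lc l) (M2Of d Lc (mixFFAt (toSite r) Lc) l))) κ u κ' u') + cB • vh₂S κ u κ' u') κ u κ' u'))) +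
           (lin4 (cE₂ * (Lc : ℝ) ^ (2 * (d + 1))) (unitK (sfStep Lc l) (smStep d Lc l) (coDressKBmAt (toSite r) Lc (KInvStep (d := d) Lc l))) Lc
              (c • (unitS₂ (sfStep Lc l) (smStep d Lc l) (T2RecAt d Lc (toSite r) cE cVH cΛ cE₂ cB Tc vh₂S (mixFFAt (toSite r) Lc) l) +
                ε • fun κ u κ' u' => sgnK (trK (unitS₂ (sfStep Lc l) (smStep d Lc l) (T2RecAt d Lc (toSite r) cE cVH cΛ cE₂ cB Tc vh₂S (mixFFAt (toSite r) Lc) l) κ u κ' u')))) -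
            lin4 (cE₂ * (Lc : ℝ) ^ (2 * (d + 1))) (unitK (sfStep Lc l) (smStep d Lc l) (KInvStep (d := d) Lc l)) Lc
              (c • (unitS₂ (sfStep Lc l) (smStep d Lc l) (T2RecAt d Lc (toSite r) cE cVH cΛ cE₂ cB Tc vh₂S (mixFFAt (toSite r) Lc) l) +
                ε • fun κ u κ' u' => sgnK (trK (unitS₂ (sfStep Lc l) (smStep d Lc l) (T2RecAt d Lc (toSite r) cE cVH cΛ cE₂ cB Tc vh₂S (mixFFAt (toSite r) Lc) l) κ u κ' u')))))) := by
  have h := unitS₂_T2RecOf_half_eq_transportB_add_sum_cell_of_letters (fun j => coDressKBmAt (toSite r) Lc (KInvStep (d := d) Lc j))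
    (fun j => KInvStep (d := d) Lc j) (SpureRecAt d Lc (toSite r) cE cVH cΛ) (M1At d Lc (toSite r) cΛ) cE₂ cB Tc (vh₂S := vh₂S) (mixFF := mixFFAt (toSite r) Lc)
    hLc hBff hBmm (fun j => decays_coDressKBmAt_KInvStep (d := d) hr j) (fun j => decays_KInvStep (d := d) (Lc := Lc) j)
    (fun j => locStencil_SpureRecAt hLc hr cE cVH cΛ j) (fun j => ⟨_, 1, one_pos, vertexFamily_M1At hLc hr cΛ j zero_le_one⟩) hB (hmix_an1 hLc hr) hpA c ε n
  simp only [T2RecOf_comb] at h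
  exact h

end Comb

end Summit.QuantumFields.BalabanUV.Beta.GAN24.AffineUnrollProjected
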